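import Literature.Probability.LatticeModels.LatticeToContinuumLip
import HarnessLib

/-!
# The vertical values merge with the horizontal ones: `|F_δ(vertical) - F_δ(horizontal)| = O(δ√δ)`

Topic `Literature/Probability/LatticeModels`; the observable-independent form of
`IsDiscretisation.exists_cross_bound` (`ObservableContinuumBounds.lean`, Smirnov 2010 §5) for an
abstract family of bond functions: if at every site with mesh point in `K` the vertical-minus-
horizontal difference is controlled by a two-step horizontal difference (`LatticeCrossHyp`, which
for a bond function s-holomorphic at the corners `(x, NE)` and `(x + e₁, SW)` is the tree's
`norm_sub_le_of_isSHolAt`), then the lattice Lipschitz hypothesis of `LatticeToContinuumLip.lean`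
gives `‖F_δ(cSrc (x,1)) - F_δ(cSrc (x,0))‖ ≤ L δ √δ` eventually (`exists_cross_bound_of_hyps`).
Everything is proved; no named fact.

## References

* S. Smirnov, Ann. of Math. 172 (2010), §5 [Smirnov2010].
* D. Chelkak, C. Hongler, K. Izyurov, Ann. of Math. 181 (2015), Thm 3.12 [ChelkakHonglerIzyurovAnnals2015].
-/

noncomputable section

namespace Literature.Probability.LatticeModels

open Filter _root_.Topology Metric Set Finset DiscreteDobrushin

/-- **The lattice cross hypothesis**: the vertical value at a site is within the two-step horizontal
difference of the horizontal value. [cite: Smirnov2010, proof of Lemma 3.6] -/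
def LatticeCrossHyp (F : ℝ → MedialVertex → ℂ) (K : Set ℂ) : Prop :=
  ∀ᶠ δ in 𝓝[>] (0 : ℝ), ∀ x : Site 2, meshPoint δ x ∈ K →
    ‖F δ (cSrc (x, 1)) - F δ (cSrc (x, 0))‖ ≤ ‖F δ (cSrc (x + cornerUnit 1 + cornerUnit 2, 0)) - F δ (cSrc (x, 0))‖

/-- **`|F_δ(vertical) - F_δ(horizontal)| ≤ L δ √δ` on `K`.** [cite: Smirnov2010, §5; ChelkakHonglerIzyurovAnnals2015, Thm 3.12] -/
theorem exists_cross_bound_of_hyps {F : ℝ → MedialVertex → ℂ} {K : Set ℂ} {ρ C' : ℝ} (hρ : 0 < ρ) (hC' : 0 ≤ C')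
    (hX : LatticeCrossHyp F K) (hL : LatticeLipHyp F K ρ C') :
    ∃ L : ℝ, 0 ≤ L ∧ ∀ᶠ δ in 𝓝[>] (0 : ℝ), ∀ x : Site 2, meshPoint δ x ∈ K →
      ‖F δ (cSrc (x, 1)) - F δ (cSrc (x, 0))‖ ≤ L * δ * Real.sqrt δ := by
  refine ⟨2 * (C' * ((200 / ρ) * Real.sqrt (200 / ρ))), by positivity, ?_⟩
  have hc : (0 : ℝ) < ρ / 2000 := by positivity
  have h2 : ∀ᶠ δ in 𝓝[>] (0 : ℝ), δ < ρ / 2000 := nhdsWithin_le_nhds (Iio_mem_nhds hc)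
  have h3 : ∀ᶠ δ in 𝓝[>] (0 : ℝ), 0 < δ := self_mem_nhdsWithin
  have hc : (0 : ℝ) < ρ / 2000 := by positivity
  have h2 : ∀ᶠ δ in 𝓝[>] (0 : ℝ), δ < ρ / 2000 := nhdsWithin_le_nhds (Iio_mem_nhds hc)
  have h3 : ∀ᶠ δ in 𝓝[>] (0 : ℝ), 0 < δ := self_mem_nhdsWithin
  filter_upwards [hX, hL, h2, h3] with δ HX HL hδs hδ0 x hx
  have key := HX x hx
  -- the Lipschitz scale `q`
  set q : ℕ := ⌊ρ / (200 * δ)⌋₊ with hqdef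
  have hqr : (0 : ℝ) < ρ / (200 * δ) := by positivity
  have hqle : (q : ℝ) ≤ ρ / (200 * δ) := Nat.floor_le hqr.le
  have hqlt : ρ / (200 * δ) < q + 1 := Nat.lt_floor_add_one _
  have hbig : (10 : ℝ) ≤ ρ / (200 * δ) := by
    rw [le_div_iff₀ (by positivity)]; linarith
  have hq8 : 8 ≤ q := by
    have : (8 : ℝ) ≤ q := by linarith
    exact_mod_cast this
  have hδq : δ * q ≤ ρ / 200 := by
    rw [le_div_iff₀ (by norm_num : (0:ℝ) < 200)]
    have := mul_le_mul_of_nonneg_left hqle (by positivity : (0 : ℝ) ≤ 200 * δ)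
    rw [mul_div_cancel₀ _ (by positivity)] at this
    linarith
  have hsize : δ * (2 * (2 * (2 * (4 * (2 * (q : ℝ))))) + 3) ≤ ρ := by nlinarith
  set Λ : ℝ := C' / ((2 * q : ℕ) * Real.sqrt (2 * q : ℕ)) with hΛ
  have hΛ0 : 0 ≤ Λ := by rw [hΛ]; positivity
  have hstep : ∀ y : Site 2, supNear x 1 y → ∀ j : Fin 4,
      ‖F δ (cSrc (y + cornerUnit j, 0)) - F δ (cSrc (y, 0))‖ ≤ Λ := by
    intro y hy j
    have hyb : y ∈ latticeBall x q := by
      rw [mem_latticeBall_iff_supNear]; exact supNear_mono hy (by exact_mod_cast (show 1 ≤ q by omega))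
    exact HL x hx q hq8 hsize y hyb j
  have htwo : supNear x 1 (x + cornerUnit 1 + cornerUnit 2) := by intro i; fin_cases i <;> simp [cornerUnit]
  have hpath := norm_sub_le_of_supNear (fun y => F δ (cSrc (y, 0))) hΛ0 htwo
    (fun y hy j => hstep y hy j)
  simp only [Nat.cast_one] at hpath
  -- `Λ ≤ 8 K C (200/ρ)^{3/2} δ √δ`
  have h2q : ρ / (200 * δ) ≤ (2 * q : ℕ) := by push_cast; linarith
  have hΛle : Λ ≤ C' * ((200 / ρ) * Real.sqrt (200 / ρ)) * (δ * Real.sqrt δ) := by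
    rw [hΛ]
    have hinv : 1 / (((2 * q : ℕ) : ℝ) * Real.sqrt (2 * q : ℕ)) ≤ (200 * δ / ρ) * Real.sqrt (200 * δ / ρ) := by
      rw [div_le_iff₀ (by positivity)]
      have hs : Real.sqrt (ρ / (200 * δ)) ≤ Real.sqrt (2 * q : ℕ) := Real.sqrt_le_sqrt h2q
      have e1 : (200 * δ / ρ) * (ρ / (200 * δ)) = 1 := by field_simp
      have e2 : Real.sqrt (200 * δ / ρ) * Real.sqrt (ρ / (200 * δ)) = 1 := by
        rw [← Real.sqrt_mul (by positivity), e1, Real.sqrt_one]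
      calc (1 : ℝ) = ((200 * δ / ρ) * (ρ / (200 * δ))) * (Real.sqrt (200 * δ / ρ) * Real.sqrt (ρ / (200 * δ))) := by
            rw [e1, e2, one_mul]
        _ ≤ ((200 * δ / ρ) * (2 * q : ℕ)) * (Real.sqrt (200 * δ / ρ) * Real.sqrt (2 * q : ℕ)) := by gcongr
        _ = (200 * δ / ρ) * Real.sqrt (200 * δ / ρ) * (((2 * q : ℕ) : ℝ) * Real.sqrt (2 * q : ℕ)) := by ring
    have e3 : (200 * δ / ρ) * Real.sqrt (200 * δ / ρ) = ((200 / ρ) * Real.sqrt (200 / ρ)) * (δ * Real.sqrt δ) := by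
      rw [show 200 * δ / ρ = (200 / ρ) * δ by ring, Real.sqrt_mul (by positivity)]; ring
    calc C' / (((2 * q : ℕ) : ℝ) * Real.sqrt (2 * q : ℕ))
        = C' * (1 / (((2 * q : ℕ) : ℝ) * Real.sqrt (2 * q : ℕ))) := by ring
      _ ≤ C' * ((200 * δ / ρ) * Real.sqrt (200 * δ / ρ)) := by gcongr
      _ = _ := by rw [e3]; ring
  calc ‖F δ (cSrc (x, 1)) - F δ (cSrc (x, 0))‖
      ≤ ‖F δ (cSrc (x + cornerUnit 1 + cornerUnit 2, 0)) - F δ (cSrc (x, 0))‖ := key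
    _ ≤ 2 * 1 * Λ := hpath
    _ ≤ 2 * 1 * (C' * ((200 / ρ) * Real.sqrt (200 / ρ)) * (δ * Real.sqrt δ)) := by gcongr
    _ = _ := by ring

/-! ### Subsequential local uniform limits of `F_δ / √δ` -/

end Literature.Probability.LatticeModels
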